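import Summits.NavierStokesRegularity.NavierStokesRegularity.Theorems.DriftChargedClockInhabitant
import HarnessLib

/-!
# StrainClockBudgetedInhabitant — EQUALITY CASES of door S41-D6 «BudgetedDriftSmoothing» with NON-ZERO budget (satisfiability certificate)

P0-41 optional file (memo §8 «file 3», landed because the S-lane keeps satisfiability on the ledger — ref3 F2): §7–§9 of nsreg-p1 g32's
`r39/Sketch43.lean` sha16 6f4265cbcae7da21 (ROUND-39 S41 «BudgetedClock», memo v1.1 2ec8562e2824807f): in namespace
`…Theorems.StrainDoors.PlanarStrain` the budget `rate κ κ' a₀` / `budget κ κ' a₀` (`budget_arg`, `budget_zero`, `one_le_budget_arg`,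
`budget_nonneg`, `budget_mono`, `hasDerivAt_budget`), §8 `strainQuad_of_isStrainPenalisedArgmax`, `totalFeed_eq_budgeted`, then §9
`budgetedDriftSmoothing_inhabited` — statements and proofs byte-identical, order preserved (docstrings added where the lint wants them).
Sketch43 §1–§6 are byte-identical to Sketch41 §1–§6 (checked by `diff`), which LANDED as p670188 `…Theorems.DriftChargedClockInhabitant`;
they are therefore DROPPED here and IMPORTED (nothing re-declared). Cut prepared by ns-s29-p2 g5,
`--supports stmt-NavierStokesRegularity-0056 --as helper`.  The sketch's module docstring follows verbatim.

HONEST FRAME: an explicit infinite-energy EXAMPLE FAMILY (finite-dimensional verification, no PDE estimate) showing D6's hypothesis class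
with non-zero budget is inhabited, with equality, by exact Navier–Stokes solutions outside D1's class; not a theorem about NS regularity;
items 0056 `NoTypeII`, 10661 and NS regularity are NOT proved; nothing here is a route or a summit statement.
-/


/-!
# Sketch43 — the EQUALITY CASES of door D6 «BudgetedDriftSmoothing» (nsreg-p1 g32, ROUND-39 addendum):
# a kernel-checked INHABITANT FAMILY of D6's frame, budget clause and hypothesis with NON-ZERO budget

ROUND-39 (Sketch42) proved the forward door D6 `BudgetedDriftSmoothing`: in S33's blow-up-permitting frame, with a
budget `Φ` (`0 ≤ Φ ≤ β`, `Φ′ = b` on `[t₀,T)`), if at every exact `ε`-penalised strain maximiser charged above the level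
`ℓ` the TOTAL feed obeys `H + √ε‖u(x̄)‖q ≤ c q² + b(t)·q` (`c < 1`, `κ = 1 − c`), then
`(1+ε‖x‖²)⁻¹⟪∇u(t,x)e,e⟫ ≤ e^{β}(ℓ + 6νε/κ + 1/(κ(t−t₀)))` on `(t₀,T)`.

THIS FILE (Sketch41 extended; §1–§6 are Sketch41 VERBATIM with the decay rate renamed `κ'`; `IsStrainPenalisedArgmax` now
IMPORTED from the landed `…Theorems.StrainClockLocalDefs`, P0-39 part 1, p667521 — nothing re-declared): the planar strains
`u(t,x) = a(t)·(x₀, −x₁, 0)`, `a(t) = (κ't + a₀⁻¹)⁻¹` with decay rate `0 < κ' ≤ κ = 1 − c` — SLOWER than D1 tolerates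
when `κ' < κ` (D1's hypothesis `≤ c q²` FAILS on them: total feed `= (1−κ')q² > c q²`) — satisfy D6's hypothesis WITH
EQUALITY for the rate `b(t) = (κ − κ')·a(t)` and the primitive `Φ(t) = ((κ−κ')/κ')·log((κ't + a₀⁻¹)·a₀)`:
`Φ(0) = 0`, `Φ′ = b`, `0 ≤ Φ ≤ Φ(T)` on `[0,T)` (§7: `rate`, `budget`, `hasDerivAt_budget`, `budget_nonneg`,
`budget_mono`), and the hypothesis is CHARGED at every time (§6). Packaged in D6's binder shapes:
`budgetedDriftSmoothing_inhabited` (§8). With `κ' = κ` the budget is zero and this is Sketch41's certificate for D1.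

HONEST LABEL: a finite-dimensional verification (explicit linear flow; `Real.log` calculus), no PDE estimate. It
certifies that D6's hypothesis class with NON-ZERO budget is inhabited, with equality, by exact Navier–Stokes solutions
outside D1's hypothesis class. Nothing here is a route, a door, or a statement about 0056 / 10661 / regularity.
-/

set_option linter.dupNamespace false

open Set Function WithLp Filter
open scoped ContDiff InnerProductSpace RealInnerProductSpace Topology

namespace Summit.NavierStokesRegularity.NavierStokesRegularity.Theorems.StrainDoors

open Literature.Analysis.FluidPDE Literature.Analysis.FluidPDE.VectorCalculus

noncomputable section

namespace PlanarStrain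

/-! ## §7 The budget: rate `b = (κ − κ')·a`, primitive `Φ = ((κ−κ')/κ')·log((κ't + a₀⁻¹)a₀)` -/

/-- the budget RATE `b(t) = (κ − κ')·a(t)` (excess of the total feed over `c q²`, per unit strain). -/
def rate (κ κ' a₀ : ℝ) (t : ℝ) : ℝ := (κ - κ') * amp κ' a₀ t

/-- the budget PRIMITIVE `Φ(t) = ((κ − κ')/κ')·log((κ't + a₀⁻¹)·a₀)`. -/
def budget (κ κ' a₀ : ℝ) (t : ℝ) : ℝ := (κ - κ') / κ' * Real.log ((κ' * t + a₀⁻¹) * a₀)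

/-- The argument of the logarithm: `(κ't + a₀⁻¹)·a₀ = κ't·a₀ + 1`. -/
theorem budget_arg {κ' a₀ t : ℝ} (ha₀ : 0 < a₀) : (κ' * t + a₀⁻¹) * a₀ = κ' * t * a₀ + 1 := by
  field_simp

/-- The budget starts at zero: `Φ(0) = 0`. -/
theorem budget_zero (κ κ' : ℝ) {a₀ : ℝ} (ha₀ : 0 < a₀) : budget κ κ' a₀ 0 = 0 := by
  rw [budget, budget_arg ha₀]
  simp

/-- `(κ't + a₀⁻¹)·a₀ ≥ 1` for `t ≥ 0`. -/
theorem one_le_budget_arg {κ' a₀ t : ℝ} (hκ' : 0 < κ') (ha₀ : 0 < a₀) (ht : 0 ≤ t) :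
    1 ≤ (κ' * t + a₀⁻¹) * a₀ := by
  rw [budget_arg ha₀]
  have : 0 ≤ κ' * t * a₀ := by positivity
  linarith

/-- The budget is nonnegative on `t ≥ 0` (for `κ' ≤ κ`). -/
theorem budget_nonneg {κ κ' a₀ t : ℝ} (hκ' : 0 < κ') (hκκ' : κ' ≤ κ) (ha₀ : 0 < a₀) (ht : 0 ≤ t) :
    0 ≤ budget κ κ' a₀ t := by
  unfold budget
  exact mul_nonneg (div_nonneg (sub_nonneg.2 hκκ') hκ'.le) (Real.log_nonneg (one_le_budget_arg hκ' ha₀ ht))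

/-- The budget is monotone: `Φ(t) ≤ Φ(T)` for `0 ≤ t ≤ T` (for `κ' ≤ κ`). -/
theorem budget_mono {κ κ' a₀ t T : ℝ} (hκ' : 0 < κ') (hκκ' : κ' ≤ κ) (ha₀ : 0 < a₀) (ht : 0 ≤ t) (htT : t ≤ T) :
    budget κ κ' a₀ t ≤ budget κ κ' a₀ T := by
  unfold budget
  apply mul_le_mul_of_nonneg_left _ (div_nonneg (sub_nonneg.2 hκκ') hκ'.le)
  apply Real.log_le_log (lt_of_lt_of_le one_pos (one_le_budget_arg hκ' ha₀ ht))
  have : κ' * t * a₀ ≤ κ' * T * a₀ :=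
    mul_le_mul_of_nonneg_right (mul_le_mul_of_nonneg_left htT hκ'.le) ha₀.le
  rw [budget_arg ha₀, budget_arg ha₀]
  linarith

/-- `Φ′ = b`: `d/dt [((κ−κ')/κ')·log((κ't + a₀⁻¹)a₀)] = ((κ−κ')/κ')·κ'a₀/((κ't + a₀⁻¹)a₀) = (κ−κ')(κ't + a₀⁻¹)⁻¹`. -/
theorem hasDerivAt_budget {κ κ' a₀ t : ℝ} (hκ' : 0 < κ') (ha₀ : 0 < a₀) (ht : 0 ≤ t) :
    HasDerivAt (budget κ κ' a₀) (rate κ κ' a₀ t) t := by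
  have hden : 0 < κ' * t + a₀⁻¹ := den_pos hκ' ha₀ ht
  have harg : (κ' * t + a₀⁻¹) * a₀ ≠ 0 := (mul_pos hden ha₀).ne'
  have h1 : HasDerivAt (fun r : ℝ => (κ' * r + a₀⁻¹) * a₀) (κ' * 1 * a₀) t := by
    have := (((hasDerivAt_id t).const_mul κ').add_const a₀⁻¹).mul_const a₀
    simpa using this
  have h2 := (h1.log harg).const_mul ((κ - κ') / κ')
  refine h2.congr_deriv ?_
  simp only [rate, amp]
  field_simp

/-! ## §8 D6's hypothesis holds — with EQUALITY — for the budget, and is charged at every time -/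

/-- At an exact penalised maximiser the strain form equals the amplitude: `q = a(t)`. -/
theorem strainQuad_of_isStrainPenalisedArgmax {κ' a₀ ε t : ℝ} (hε : 0 < ε) (ha : 0 < amp κ' a₀ t)
    {x e : EuclideanSpace ℝ (Fin 3)} (h : IsStrainPenalisedArgmax ε (u κ' a₀) t x e) :
    strainQuad (u κ' a₀) t x e = amp κ' a₀ t := by
  obtain ⟨_, he0, he1, _⟩ := eq_of_isStrainPenalisedArgmax hε ha h
  rw [strainQuad_u, he0, he1]
  ring

/-- **EQUALITY in D6's hypothesis**: at every exact penalised maximiser, TOTAL feed `= c q² + b(t)·q` with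
`c = 1 − κ`, `b = (κ − κ')·a`. -/
theorem totalFeed_eq_budgeted {κ κ' a₀ ε t : ℝ} (hε : 0 < ε) (ha : 0 < amp κ' a₀ t)
    {x e : EuclideanSpace ℝ (Fin 3)} (h : IsStrainPenalisedArgmax ε (u κ' a₀) t x e) :
    strainFeed (u κ' a₀) (p κ' a₀) t x e + Real.sqrt ε * ‖u κ' a₀ t x‖ * strainQuad (u κ' a₀) t x e =
      (1 - κ) * strainQuad (u κ' a₀) t x e ^ 2 + rate κ κ' a₀ t * strainQuad (u κ' a₀) t x e := by
  rw [totalFeed_eq_of_isStrainPenalisedArgmax hε ha h, rate, ← strainQuad_of_isStrainPenalisedArgmax hε ha h]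
  ring

end PlanarStrain

/-! ## §9 Packaged in D6's binder shapes: `BudgetedDriftSmoothing` is inhabited with non-zero budget -/

open PlanarStrain in
/-- **Satisfiability certificate for D6 «BudgetedDriftSmoothing»** (`t₀ = 0`, `β = Φ(T)`). For every `ν`, `T`,
`ε > 0`, level `ℓ`, constant `c` and decay rate `κ'` with `0 < κ' ≤ 1 − c`, and amplitude `a₀ > 0`, the planar strain
`u(t,x) = (κ't + a₀⁻¹)⁻¹(x₀,−x₁,0)` with its Craik–Criminale pressure
(i) is a classical Navier–Stokes solution on `[0,T) × ℝ³` with force `0` (D6's frame, first clause);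
(ii) has velocity gradient bounded on every `[0,T′]` (second clause);
(iii) the budget `Φ = budget (1−c) κ' a₀`, `b = rate (1−c) κ' a₀` satisfies D6's budget clause on `[0,T)` with
`β = Φ(T)` and `Φ(0) = 0`;
(iv) D6's total-feed hypothesis holds at every charged exact `ε`-penalised maximiser — with EQUALITY (§8);
(v) the hypothesis is charged at every `t ∈ [0,T)` whenever `ℓ < (κ'T + a₀⁻¹)⁻¹`.
For `κ' < 1 − c` these flows VIOLATE D1's hypothesis (total feed `(1−κ')q² > c q²`): the budget is what admits them. -/
theorem budgetedDriftSmoothing_inhabited (ν T ε ℓ c κ' a₀ : ℝ) (hε : 0 < ε) (hκ' : 0 < κ') (hκ'c : κ' ≤ 1 - c)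
    (ha₀ : 0 < a₀) :
    IsClassicalNSSolutionOn (Ico 0 T) ν 0 (u κ' a₀) (p κ' a₀) ∧
    (∀ T' : ℝ, T' < T → ∃ K : ℝ, ∀ t ∈ Icc (0 : ℝ) T', ∀ x : EuclideanSpace ℝ (Fin 3),
        ‖fderiv ℝ (u κ' a₀ t) x‖ ≤ K) ∧
    (budget (1 - c) κ' a₀ 0 = 0 ∧
      ∀ t ∈ Ico (0 : ℝ) T, 0 ≤ budget (1 - c) κ' a₀ t ∧ budget (1 - c) κ' a₀ t ≤ budget (1 - c) κ' a₀ T ∧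
        HasDerivAt (budget (1 - c) κ' a₀) (rate (1 - c) κ' a₀ t) t) ∧
    (∀ t ∈ Ico (0 : ℝ) T, ∀ (x e : EuclideanSpace ℝ (Fin 3)), IsStrainPenalisedArgmax ε (u κ' a₀) t x e →
        ℓ < (1 + ε * ‖x‖ ^ 2)⁻¹ * strainQuad (u κ' a₀) t x e →
        strainFeed (u κ' a₀) (p κ' a₀) t x e + Real.sqrt ε * ‖u κ' a₀ t x‖ * strainQuad (u κ' a₀) t x e ≤
          c * strainQuad (u κ' a₀) t x e ^ 2 + rate (1 - c) κ' a₀ t * strainQuad (u κ' a₀) t x e) ∧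
    (∀ t ∈ Ico (0 : ℝ) T,
        IsStrainPenalisedArgmax ε (u κ' a₀) t 0 (EuclideanSpace.single 0 1) ∧
        (1 + ε * ‖(0 : EuclideanSpace ℝ (Fin 3))‖ ^ 2)⁻¹ *
            strainQuad (u κ' a₀) t 0 (EuclideanSpace.single 0 1) = (κ' * t + a₀⁻¹)⁻¹ ∧
        (κ' * T + a₀⁻¹)⁻¹ < (κ' * t + a₀⁻¹)⁻¹) := by
  have hκκ' : κ' ≤ 1 - c := hκ'c
  refine ⟨PlanarStrain.isClassicalNSSolutionOn hκ' ha₀ ν T, fun T' _ => ⟨a₀ * ‖D‖, fun t ht x =>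
    fderiv_bound hκ' ha₀ ht.1 x⟩, ⟨budget_zero _ _ ha₀, fun t ht => ⟨budget_nonneg hκ' hκκ' ha₀ ht.1,
    budget_mono hκ' hκκ' ha₀ ht.1 ht.2.le, hasDerivAt_budget hκ' ha₀ ht.1⟩⟩,
    fun t ht x e hpen _ => ?_, charged_origin hκ' ha₀ hε T⟩
  have h := totalFeed_eq_budgeted (κ := 1 - c) hε (amp_pos hκ' ha₀ ht.1) hpen
  have hc' : (1 - (1 - c)) = c := by ring
  rw [hc'] at h
  exact h.le

end

end Summit.NavierStokesRegularity.NavierStokesRegularity.Theorems.StrainDoors
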